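import Literature.Topology.FourManifolds.IwaseToriT1
import Literature.Topology.FourManifolds.TorusSurgeryShear
import Literature.Topology.FourManifolds.TorusSurgeryIwaseReduction
import HarnessLib

/-!
# Proof of Iwase's Proposition 3.5: the Gluck twist is a torus surgery

We discharge the named fact `Iwase1988_gluckTwist_isTorusLinkSurgery` of `TorusSurgery.lean`:
for every 2-knot `K` and every Gluck twist `X` of `S⁴` along `K`, `X` is a torus surgery along a
single torus with an integral unimodular gluing matrix.  By the reduction
`TorusSurgeryIwaseReduction.iwase1988_of_model` it suffices to produce the `K`- and
`X`-independent model datum on `S² × ℝ²`: the maps `Φ`, `Ψ` (`IwaseModelMaps`), the tubular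
neighbourhoods `T₀`, `T₁` of the singular torus `Σ₀` (`IwaseToriT0`, `IwaseToriT1`, squeezed to a
common injectivity radius `eps`), the far-field identity `Φ = G⁻¹` (`Phi_far`), and the exact tube
relation `Φ p = T₁ b ↔ b.2 ≠ 0 ∧ p = T₀ (shear b)` (`Phi_eq_T1_iff`), with the shear matrix
`shearMatrixPos = (1,0,1; 0,1,0; 0,0,1)` (`TorusSurgeryShear.exists_angles_iff_shearPos`).
This is Iwase's proof [cite: Iwase1988, Prop. 3.5, p. 296, proof p. 297]: the Gluck map is
isotopic, relative to a neighbourhood of the poles, to a map supported near the torus obtained by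
attaching a tube to the two polar discs, and that map is the regluing of a tubular neighbourhood
of the torus by "meridian ↦ meridian + longitude".

## References
* Z. Iwase, *Dehn-surgery along a torus T²-knot*, Pacific J. Math. 133 (1988), 289–299,
  Prop. 3.5. [cite: Iwase1988]
-/

open scoped ContDiff Topology Manifold
open Set Function Real Filter Metric

noncomputable section

namespace Literature.Topology.FourManifolds

namespace IwaseTori

open IwaseHandle UnknotSurgery

/-! ### The common injectivity radius and the two tori -/

/-- A common tube radius on which both pre-maps are injective. [folklore] -/
theorem exists_eps : ∃ ε > 0, InjOn T0pre (univ ×ˢ ball (0 : EuclideanSpace ℝ (Fin 2)) ε) ∧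
    InjOn T1pre (univ ×ˢ ball (0 : EuclideanSpace ℝ (Fin 2)) ε) := by
  obtain ⟨ε₀, h0, hi0⟩ := exists_injOn_T0pre
  obtain ⟨ε₁, h1, hi1⟩ := exists_injOn_T1pre
  refine ⟨min ε₀ ε₁, lt_min h0 h1, hi0.mono ?_, hi1.mono ?_⟩
  · exact prod_mono le_rfl (ball_subset_ball (min_le_left _ _))
  · exact prod_mono le_rfl (ball_subset_ball (min_le_right _ _))

/-- **The tube radius** of the Iwase tori. [folklore] -/
def eps : ℝ := Classical.choose exists_eps

/-- `eps > 0`. [folklore] -/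
theorem eps_pos : 0 < eps := (Classical.choose_spec exists_eps).1

/-- `T0pre` is injective on the `eps`-tube. [folklore] -/
theorem injOn_T0pre : InjOn T0pre (univ ×ˢ ball (0 : EuclideanSpace ℝ (Fin 2)) eps) :=
  (Classical.choose_spec exists_eps).2.1

/-- `T1pre` is injective on the `eps`-tube. [folklore] -/
theorem injOn_T1pre : InjOn T1pre (univ ×ˢ ball (0 : EuclideanSpace ℝ (Fin 2)) eps) :=
  (Classical.choose_spec exists_eps).2.2

/-- **The first Iwase torus** `T₀ : T² × ℝ² → S² × ℝ²` (tubular neighbourhood of `Σ₀`). [folklore] -/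
def T0 : (sphere (0 : EuclideanSpace ℝ (Fin 2)) 1 × sphere (0 : EuclideanSpace ℝ (Fin 2)) 1) × EuclideanSpace ℝ (Fin 2) →
    sphere (0 : EuclideanSpace ℝ (Fin 3)) 1 × EuclideanSpace ℝ (Fin 2) := sqz T0pre eps

/-- **The second Iwase torus** `T₁ : T² × ℝ² → S² × ℝ²` (tubular neighbourhood of `Σ₁ = Σ₀`, reglued).
[folklore] -/
def T1 : (sphere (0 : EuclideanSpace ℝ (Fin 2)) 1 × sphere (0 : EuclideanSpace ℝ (Fin 2)) 1) × EuclideanSpace ℝ (Fin 2) →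
    sphere (0 : EuclideanSpace ℝ (Fin 3)) 1 × EuclideanSpace ℝ (Fin 2) := sqz T1pre eps

/-- **`T₀` is a smooth embedding.** [folklore] -/
theorem isSmoothEmbedding_T0 : Manifold.IsSmoothEmbedding (((𝓡 1).prod (𝓡 1)).prod 𝓘(ℝ, EuclideanSpace ℝ (Fin 2)))
    ((𝓡 2).prod 𝓘(ℝ, EuclideanSpace ℝ (Fin 2))) ∞ T0 :=
  isSmoothEmbedding_sqz isLocalDiffeomorph_T0pre eps_pos injOn_T0pre

/-- **`T₁` is a smooth embedding.** [folklore] -/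
theorem isSmoothEmbedding_T1 : Manifold.IsSmoothEmbedding (((𝓡 1).prod (𝓡 1)).prod 𝓘(ℝ, EuclideanSpace ℝ (Fin 2)))
    ((𝓡 2).prod 𝓘(ℝ, EuclideanSpace ℝ (Fin 2))) ∞ T1 :=
  isSmoothEmbedding_sqz isLocalDiffeomorph_T1pre eps_pos injOn_T1pre

/-- **The core of `T₀` is `Σ₀`.** [folklore] -/
theorem range_T0_core : range (fun x : sphere (0 : EuclideanSpace ℝ (Fin 2)) 1 × sphere (0 : EuclideanSpace ℝ (Fin 2)) 1 =>
    T0 (x, 0)) = Sigma0 := by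
  have : (fun x : sphere (0 : EuclideanSpace ℝ (Fin 2)) 1 × sphere (0 : EuclideanSpace ℝ (Fin 2)) 1 => T0 (x, 0)) =
      fun x => T0pre (x, 0) := by funext x; exact sqz_zero _ _ x
  rw [this, range_T0pre_core]

/-- **The core of `T₁` is `Σ₀`.** [folklore] -/
theorem range_T1_core : range (fun x : sphere (0 : EuclideanSpace ℝ (Fin 2)) 1 × sphere (0 : EuclideanSpace ℝ (Fin 2)) 1 =>
    T1 (x, 0)) = Sigma0 := by
  have : (fun x : sphere (0 : EuclideanSpace ℝ (Fin 2)) 1 × sphere (0 : EuclideanSpace ℝ (Fin 2)) 1 => T1 (x, 0)) =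
      fun x => T1pre (x, 0) := by funext x; exact sqz_zero _ _ x
  rw [this, range_T1pre_core]

/-! ### The exact tube relation -/

/-- **`Φ ∘ T₀ ∘ shear = T₁` off the zero section.** [folklore] -/
theorem Phi_T0_shearPos {b : (sphere (0 : EuclideanSpace ℝ (Fin 2)) 1 × sphere (0 : EuclideanSpace ℝ (Fin 2)) 1) ×
    EuclideanSpace ℝ (Fin 2)} (hb : b.2 ≠ 0) : Phi (T0 (shearPos b)) = T1 b := by
  obtain ⟨⟨z₁, z₂⟩, v⟩ := b
  have hv : OpenPartialHomeomorph.univBall (0 : EuclideanSpace ℝ (Fin 2)) eps v ≠ 0 :=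
    fun h => hb ((univBall_zero_eq_zero_iff eps_pos).1 h)
  change Phi (T0pre ((circleMul (unitVector₀ v) z₁, z₂), OpenPartialHomeomorph.univBall (0 : EuclideanSpace ℝ (Fin 2)) eps v)) =
    T1pre ((z₁, z₂), OpenPartialHomeomorph.univBall (0 : EuclideanSpace ℝ (Fin 2)) eps v)
  rw [← unitVector₀_univBall eps_pos v, Phi_T0pre_shear z₁ z₂ hv]

/-- Sheared tube points off the zero section are off `Σ₀`. [folklore] -/
theorem T0_shearPos_not_mem {b : (sphere (0 : EuclideanSpace ℝ (Fin 2)) 1 × sphere (0 : EuclideanSpace ℝ (Fin 2)) 1) ×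
    EuclideanSpace ℝ (Fin 2)} (hb : b.2 ≠ 0) : T0 (shearPos b) ∉ Sigma0 := by
  obtain ⟨⟨z₁, z₂⟩, v⟩ := b
  have hv : OpenPartialHomeomorph.univBall (0 : EuclideanSpace ℝ (Fin 2)) eps v ≠ 0 :=
    fun h => hb ((univBall_zero_eq_zero_iff eps_pos).1 h)
  exact T0pre_not_mem injOn_T0pre (univBall_mem_ball eps_pos v) hv

/-- Core tube points are on `Σ₀`. [folklore] -/
theorem T1_zero_mem (x : sphere (0 : EuclideanSpace ℝ (Fin 2)) 1 × sphere (0 : EuclideanSpace ℝ (Fin 2)) 1) :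
    T1 (x, 0) ∈ Sigma0 := by
  rw [← range_T1_core]; exact ⟨x, rfl⟩

/-- **The tube relation**: for `p ∉ Σ₀`, `Φ p = T₁ b ↔ b.2 ≠ 0 ∧ p = T₀ (shear b)`. [folklore] -/
theorem Phi_eq_T1_iff {p : sphere (0 : EuclideanSpace ℝ (Fin 3)) 1 × EuclideanSpace ℝ (Fin 2)} (hp : p ∉ Sigma0)
    (b : (sphere (0 : EuclideanSpace ℝ (Fin 2)) 1 × sphere (0 : EuclideanSpace ℝ (Fin 2)) 1) × EuclideanSpace ℝ (Fin 2)) :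
    Phi p = T1 b ↔ b.2 ≠ 0 ∧ p = T0 (shearPos b) := by
  constructor
  · intro h
    have hb : b.2 ≠ 0 := by
      intro hb0
      have hmem : T1 b ∈ Sigma0 := by
        rw [show b = (b.1, b.2) from rfl, hb0]; exact T1_zero_mem b.1
      have := (Psi_Phi hp).1
      rw [Sigma1_eq, h] at this
      exact this hmem
    refine ⟨hb, ?_⟩
    have h2 : Phi (T0 (shearPos b)) = Phi p := by rw [Phi_T0_shearPos hb, h]
    have := congrArg Psi h2
    rwa [(Psi_Phi (T0_shearPos_not_mem hb)).2, (Psi_Phi hp).2, eq_comm] at this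
  · rintro ⟨hb, rfl⟩
    exact Phi_T0_shearPos hb

end IwaseTori

open IwaseTori IwaseHandle in
/-- **Iwase's Proposition 3.5: the Gluck twist along a 2-knot is the torus surgery along the
spun/attached torus with the shear matrix `(θ₁, θ₂, θ₃) ↦ (θ₁ + θ₃, θ₂, θ₃)`.**  Proof: the
reduction `iwase1988_of_model` applied to the explicit model datum on `S² × ℝ²` constructed in
`IwasePolarModel`, `UnknotSurgeryModel`, `IwaseHandle*`, `IwaseModelMaps` (the maps `Φ`, `Ψ` and the
singular torus `Σ₀`) and `IwaseTori*` (the tubular neighbourhoods `T₀`, `T₁` with the exact tube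
relation `Φ ∘ T₀ ∘ shear = T₁`). [cite: Iwase1988, Prop. 3.5, p. 296 (proof p. 297)] -/
theorem Iwase1988_gluckTwist_isTorusLinkSurgery_holds : Iwase1988_gluckTwist_isTorusLinkSurgery :=
  iwase1988_of_model (A := shearMatrixPos) (Or.inl det_shearMatrixPos) isSmoothEmbedding_T0 isSmoothEmbedding_T1
    (Φ := Phi) (Ψ := Psi)
    (by rw [range_T0_core]; exact contMDiffOn_Phi)
    (by rw [range_T1_core, ← Sigma1_eq]; exact contMDiffOn_Psi)
    (fun p hp => by
      rw [range_T0_core] at hp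
      rw [range_T1_core, ← Sigma1_eq]
      exact Psi_Phi hp)
    (fun q hq => by
      rw [range_T1_core, ← Sigma1_eq] at hq
      rw [range_T0_core]
      exact Phi_Psi hq)
    ⟨4, fun p hp => Phi_far hp⟩
    (fun p hp b => by
      rw [range_T0_core] at hp
      rw [exists_angles_iff_shearPos T0 p b]
      exact Phi_eq_T1_iff hp b)

end Literature.Topology.FourManifolds
end
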